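import Summits.RiemannHypothesis.RiemannHypothesis.Theorems.ThetaTier2RowSound
import HarnessLib

/-!
# THETA tier-2 kernel rows — twin primes `2711 ≤ q ≤ 3461` (module 5 of 13; cc-s2-1, WEIL typing lane; RH-FREE bookkeeping)

Data module of the tier-2 theta certificate (THETA-CERT-cc6 §E; HOME/cc-s2-1/gen22/TIER2-KERNEL-SPEC.md; soundness chain
`ThetaTier2Check … ThetaTier2RowSound`): the rows `(q, q⁺, m, δ·10¹², menu, k)` — `m = 5`, `δ = ⌊0.98·δ_q·10¹²⌋/10¹²` with
`δ_q = ½ log(q⁺/q)`, menu `0` = thin seed `(1/20, 19/20, 1)`, `η′ = 1/100` (menu `1` = `(1/4, 3/5, 1)`, `η′ = 1/20` for `q = 179, 191`),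
`t₀ = 2⁻¹⁵`; `K = 6`, `τ = 1/100`, `D = 3`, `W_l = 4`, `J = 64` — for the twin primes `2711 ≤ q ≤ 3461` in the range of the route item
`stmt-RiemannHypothesis-19172` (`WallsTenKTwin`, `route-RiemannHypothesis-WeilSemilocal`), checked in the kernel by `Row2.check`
(`decide +kernel`, ≈ 14 s per row), and the resulting REAL statements `T2Valid r.inp r.real ∧ r.RowFacts` (`Row2.check_sound`) that the
E-side assembly turns into `UC(q)`.  Nothing here bears on the truth of RH.
-/

set_option linter.dupNamespace false  -- the mandated namespace repeats `RiemannHypothesis`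

namespace Summit.RiemannHypothesis.RiemannHypothesis.Theorems.ThetaTier2

/-- Twin rows `2711 ≤ q ≤ 3167` (8 rows). [this cell, TIER2-KERNEL-SPEC §4] -/
def twinRows05_1 : List Row2 := [
  ⟨2711, 2713, 5, 361356948, 0, 15⟩, ⟨2729, 2731, 5, 358974375, 0, 15⟩, ⟨2789, 2791, 5, 351254495, 0, 15⟩, ⟨2801, 2803, 5, 349750193, 0, 15⟩,
  ⟨2969, 2971, 5, 329966342, 0, 15⟩, ⟨2999, 3001, 5, 326666678, 0, 15⟩, ⟨3119, 3121, 5, 314102574, 0, 15⟩, ⟨3167, 3169, 5, 309343444, 0, 15⟩ ]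

/-- The kernel verdict for `twinRows05_1`. [this cell, THETA-CERT-cc6 §E6] -/
theorem twinRows05_1_check : twinRows05_1.all Row2.check = true := by
  decide +kernel

/-- (K1)–(K7) and the row facts at every row of `twinRows05_1`. [this cell, THETA-CERT-cc6 §E6] -/
theorem twinRows05_1_valid : ∀ r ∈ twinRows05_1, T2Valid r.inp r.real ∧ r.RowFacts :=
  fun r hr => r.check_sound (List.all_eq_true.1 twinRows05_1_check r hr)

/-- Twin rows `3251 ≤ q ≤ 3461` (8 rows). [this cell, TIER2-KERNEL-SPEC §4] -/
def twinRows05_2 : List Row2 := [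
  ⟨3251, 3253, 5, 301353023, 0, 15⟩, ⟨3257, 3259, 5, 300798045, 0, 15⟩, ⟨3299, 3301, 5, 296969706, 0, 15⟩, ⟨3329, 3331, 5, 294294303, 0, 15⟩,
  ⟨3359, 3361, 5, 291666675, 0, 15⟩, ⟨3371, 3373, 5, 290628715, 0, 15⟩, ⟨3389, 3391, 5, 289085554, 0, 15⟩, ⟨3461, 3463, 5, 283073375, 0, 15⟩ ]

/-- The kernel verdict for `twinRows05_2`. [this cell, THETA-CERT-cc6 §E6] -/
theorem twinRows05_2_check : twinRows05_2.all Row2.check = true := by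
  decide +kernel

/-- (K1)–(K7) and the row facts at every row of `twinRows05_2`. [this cell, THETA-CERT-cc6 §E6] -/
theorem twinRows05_2_valid : ∀ r ∈ twinRows05_2, T2Valid r.inp r.real ∧ r.RowFacts :=
  fun r hr => r.check_sound (List.all_eq_true.1 twinRows05_2_check r hr)

end Summit.RiemannHypothesis.RiemannHypothesis.Theorems.ThetaTier2
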